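import Literature.AnabelianGeometry.SemiGraphs.PSCCuspTwistTransfer
import Literature.AnabelianGeometry.SemiGraphs.PSCSeparatingCoveringsIrreducibleNodalClosedEdges
import Literature.AnabelianGeometry.SemiGraphs.PSCSeparatingCoveringsIrreducibleNodal
import HarnessLib

/-!
# [CombGC] Prop. 1.2, proof p. 9: EDGE-LIKE separating coverings at the ONE-CUSP irreducible nodal carrier `Π = Γ̂_{g,1}`, `g ≥ 2`

Mochizuki, *A combinatorial version of the Grothendieck conjecture* [CombGC], PROOF of Prop. 1.2, p. 9, the
resp'd (edge) case [cite: MochizukiCombGC2007, Prop 1.2 proof p.9], typed LEVEL-WISE as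
`PSCDatum.EdgeLikeSeparatingCoverings` (row P12-L01-E; instance form of abc-iut FACT-LIST row F-2827), with
Prop. 1.2 (i)/(ii) via abc-iut-w5-d183's `prop12_of_separating`.

PROOF-ONLY file (abc-iut-f-060 gen 9; row «NODE-RESIDUAL@UNMARKED», census stratum (4) of abc-iut-L3-lead δ11;
0 definitions).  The carrier: the irreducible one-nodal datum with ONE cusp (`exists_irreducibleNodalDatum Σ g 1`),
arithmetic genus `g ≥ 2`: one vertex `cl ι⟨b_0, a_0 b_0 a_0⁻¹, a_i, b_i (i ≥ 1), c_0⟩`, the loop node `cl ι⟨b_0⟩`,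
the cusp `cl ι⟨c_0⟩` with `c_0 = (∏_i [a_i,b_i])⁻¹`.  The four types of edge pairs of F-2827:
node/node — the LOOP TWIST (`loopTwist_exists_open_separating_sameNode`, p504951/p505855); node alive / cusp
killed — the CHARACTER `b_0 ↦ 1`, cusps `↦ 0` (abc-iut-f-164's `exists_open_separating_of_character`); cusp
alive / node killed and cusp/cusp — the CUSP TWIST (`cuspTwist_exists_open_separating_of_plain` /
`_sameCusp`: `c_0` twisted, handle `g − 1 ≥ 1` cancelling, `b_0` PLAIN).

* `edgeLikeSeparatingCoverings_of_irreducibleNodalOneCusp` — ★ F-2827 (`V' := V`) at EVERY such datum;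
* `separatingCoverings_of_irreducibleNodalOneCusp` (F-2829; with abc-iut-w5-d174's
  `verticialSeparatingCoverings_of_irreducibleNodal_affine` and abc-iut-f-164's `unrRows_of_irreducibleNodal`),
  `prop12_of_irreducibleNodalOneCusp` — ALL FIVE typed clauses of Prop. 1.2 (i)/(ii);
* `irreducibleNodalOneCuspOrigin_prop12_rows`, `exists_irreducibleNodalOneCuspOrigin_prop12_holds_all` — F-0438
  (both clauses), F-0459, F-2830 at every origin of such data, NON-VACUOUSLY (every `g ≥ 2`, every `Σ`).

HONEST-OPEN after this file: the pointed nodal cubic `Γ_{1,1}` (`g = 1`, one cusp): there the cusp-alive /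
node-killed pair is IMPOSSIBLE at `V' = V` (`c_0 = [a_0,b_0]⁻¹ ∈ ⟨⟨b_0⟩⟩`), so the typed `∃ V' ≤ V` must be used
with `V' < V` (print's "replacing `G` by a finite étale covering", Rmk. 1.1.5) — not done here.  Instance forms at
data of the shape of genuine stable curves; nothing here takes a side on [IUTchIII] Cor. 3.12.
-/

noncomputable section

namespace Literature.AnabelianGeometry.SemiGraphs

open scoped Pointwise
open Literature.GroupTheory.CombinatorialGroupTheory
open Literature.GroupTheory.CombinatorialGroupTheory.PuncturedSurfaceGroup (a b c cuspInertia lift_relator)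
open SemiGraphOfAnabelioids (IsProSigmaCompletion)
open SemiGraphOfAnabelioids.IsProSigmaCompletion (loopTwist_exists_open_separating_sameNode
  cuspTwist_exists_open_separating_sameCusp cuspTwist_exists_open_separating_of_plain
  exists_open_separating_of_character)
open Multiplicative

/-! ### The character seeing `b_0` and killing the cusps -/

/-- A character `Γ_{g,r} → ℤ` with `b_{i₀} ↦ 1`, every other generator `↦ 0` (the relator is a product of
commutators and of the cusps `c_j ↦ 0`). [cite: MochizukiSemiAnbd2006, Ex. 2.10 p.31] -/
theorem PSCDatum.exists_character_b_cusps_one {g r : ℕ} (i₀ : Fin g) :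
    ∃ Ψ : PuncturedSurfaceGroup g r →* Multiplicative ℤ, Ψ (b i₀) = ofAdd 1 ∧ ∀ j, Ψ (c j) = 1 := by
  classical
  let f : puncturedSurfaceGen g r → Multiplicative ℤ :=
    Sum.elim (fun p => if p = (i₀, true) then ofAdd 1 else 1) fun _ => 1
  have hrel : ∀ R ∈ ({PuncturedSurfaceGroup.relator g r} : Set (FreeGroup (puncturedSurfaceGen g r))),
      FreeGroup.lift f R = 1 := by
    intro R hR
    rw [Set.mem_singleton_iff] at hR
    rw [hR, lift_relator]
    have h1 : ((List.finRange g).map fun i => f (Sum.inl (i, false)) * f (Sum.inl (i, true)) *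
        (f (Sum.inl (i, false)))⁻¹ * (f (Sum.inl (i, true)))⁻¹).prod = 1 :=
      List.prod_eq_one fun y hy => by
        obtain ⟨i, -, rfl⟩ := List.mem_map.mp hy
        rw [mul_inv_cancel_comm, mul_inv_cancel]
    have h2 : ((List.finRange r).map fun j => f (Sum.inr j)).prod = 1 :=
      List.prod_eq_one fun y hy => by
        obtain ⟨j, -, rfl⟩ := List.mem_map.mp hy
        rfl
    rw [h1, h2, one_mul]
  refine ⟨PresentedGroup.toGroup hrel, ?_, fun j => ?_⟩
  · change PresentedGroup.toGroup hrel (PresentedGroup.of _) = _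
    rw [PresentedGroup.toGroup.of]
    simp [f]
  · change PresentedGroup.toGroup hrel (PresentedGroup.of _) = _
    rw [PresentedGroup.toGroup.of]
    simp [f]

/-! ### The one-cusp irreducible nodal carrier -/

namespace PSCDatum

variable {P : Type} [Group P] [TopologicalSpace P] [IsTopologicalGroup P]
variable [CompactSpace P] [TotallyDisconnectedSpace P] {Sigma : Set ℕ} {g : ℕ}

/-- **Row F-2827 `EdgeLikeSeparatingCoverings` (`V' := V`) at EVERY irreducible one-nodal datum with ONE cusp
and arithmetic genus `g ≥ 2`** (`Π` a pro-`Σ` completion of `Γ_{g,1}`, loop node `cl ι⟨b_0⟩`, cusp `cl ι⟨c_0⟩`):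
node/node by the loop twist, node/cusp by the character `b_0 ↦ 1`, cusp/node and cusp/cusp by the cusp twist.
[cite: MochizukiCombGC2007, Prop 1.2 proof p.9] -/
theorem edgeLikeSeparatingCoverings_of_irreducibleNodalOneCusp (hne : Sigma.Nonempty)
    (hprime : ∀ p ∈ Sigma, p.Prime) (ι : PuncturedSurfaceGroup g 1 →* P)
    (hι : IsProSigmaCompletion Sigma ι) (G : PSCDatum P) (hg : 1 ≤ g) (hg2 : 2 ≤ g)
    (e : G.graph.C ≃ Fin 1)
    (hC : ∀ c', G.cuspGp c' = ((cuspInertia (g := g) (e c')).map ι).topologicalClosure)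
    (n₀ : G.graph.N) (hN : ∀ n, n = n₀)
    (hE : G.nodeGp n₀ = ((Subgroup.zpowers (PuncturedSurfaceGroup.b (r := 1) (⟨0, hg⟩ : Fin g))).map
      ι).topologicalClosure) :
    G.EdgeLikeSeparatingCoverings := by
  classical
  obtain ⟨ℓ, hℓS⟩ := hne
  have hℓ : ℓ.Prime := hprime ℓ hℓS
  have hr : (1 : ℕ) ≤ 1 := le_rfl
  have he0 : ∀ c', e c' = (⟨0, hr⟩ : Fin 1) := fun c' => Fin.ext (by have := (e c').isLt; omega)
  have hC' : ∀ c', G.cuspGp c' =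
      ((Subgroup.zpowers (c (g := g) (⟨0, hr⟩ : Fin 1))).map ι).topologicalClosure := fun c' => by
    rw [hC c', he0 c']; rfl
  -- the character `b_0 ↦ 1`, cusps `↦ 0`
  obtain ⟨Ψ, hΨb, hΨc⟩ := exists_character_b_cusps_one (g := g) (r := 1) ⟨0, hg⟩
  have hΨcusp : ∀ y ∈ cuspInertia (g := g) (r := 1) (⟨0, hr⟩ : Fin 1), Ψ y = 1 := by
    intro y hy
    obtain ⟨k, rfl⟩ := Subgroup.mem_zpowers_iff.mp hy
    rw [map_zpow, hΨc, one_zpow]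
  have hΨb' : Ψ (b ⟨0, hg⟩) ≠ 1 := by
    rw [hΨb]; exact fun h => absurd (ofAdd_eq_one.mp h) one_ne_zero
  have hbE : ι (b ⟨0, hg⟩) ∈ G.nodeGp n₀ := by
    rw [hE]; exact Subgroup.le_topologicalClosure _ (Subgroup.mem_map_of_mem ι (Subgroup.mem_zpowers _))
  -- `⟨b_0⟩` is generated by a plain letter of the cusp twist (`0 < g − 1`)
  have hplain : Subgroup.zpowers (b (r := 1) (⟨0, hg⟩ : Fin g)) ≤
      Subgroup.closure {s : PuncturedSurfaceGroup g 1 |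
        (∃ i : Fin g, (i : ℕ) < g - 1 ∧ (s = a i ∨ s = b i)) ∨ ∃ j : Fin 1, (j : ℕ) ≠ 0 ∧ s = c j} := by
    rw [Subgroup.zpowers_le]
    exact Subgroup.subset_closure (Or.inl ⟨⟨0, hg⟩, by simp only; omega, Or.inr rfl⟩)
  intro V hVn hVo
  haveI := hVn
  refine ⟨V, hVn, hVo, le_rfl, fun e₁ e₂ γ₁ γ₂ hdist => ?_⟩
  rcases e₁ with n₁ | c₁
  · rcases e₂ with n₂ | c₂
    · -- node / node: the loop twist
      obtain rfl : n₁ = n₀ := hN n₁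
      obtain rfl : n₂ = n₁ := hN n₂
      have hne' : DoubleCoset.doubleCoset (ConjAct.ofConjAct γ₁) (V : Set P) (G.nodeGp n₂ : Set P) ≠
          DoubleCoset.doubleCoset (ConjAct.ofConjAct γ₂) (V : Set P) (G.nodeGp n₂ : Set P) := by
        rcases hdist with h | h
        · exact absurd rfl h
        · exact h
      exact loopTwist_exists_open_separating_sameNode hι hg2 hℓ hℓS (G.nodeGp n₂) hE V hVo γ₁ γ₂ hne'
    · -- node alive / cusp killed: the character
      obtain rfl : n₁ = n₀ := hN n₁
      exact exists_open_separating_of_character hι hℓ hℓS Ψ (G.cuspGp c₂) (cuspInertia (e c₂)) (hC c₂)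
        (by rw [he0 c₂]; exact hΨcusp) (G.nodeGp n₁) (b ⟨0, hg⟩) hbE hΨb' V hVo γ₁ γ₂
  · rcases e₂ with n₂ | c₂
    · -- cusp alive / node killed: the cusp twist, `b_0` plain
      obtain rfl : n₂ = n₀ := hN n₂
      exact cuspTwist_exists_open_separating_of_plain hι hg hr hℓ hℓS (G.cuspGp c₁) (hC' c₁) _ hplain
        (G.nodeGp n₂) hE V hVo γ₁ γ₂
    · -- cusp / cusp: the cusp twist
      obtain rfl : c₁ = c₂ := e.injective ((he0 c₁).trans (he0 c₂).symm)
      have hne' : DoubleCoset.doubleCoset (ConjAct.ofConjAct γ₁) (V : Set P) (G.cuspGp c₁ : Set P) ≠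
          DoubleCoset.doubleCoset (ConjAct.ofConjAct γ₂) (V : Set P) (G.cuspGp c₁ : Set P) := by
        rcases hdist with h | h
        · exact absurd rfl h
        · exact h
      exact cuspTwist_exists_open_separating_sameCusp hι hg hr hℓ hℓS (G.cuspGp c₁) (hC' c₁) V hVo γ₁ γ₂ hne'

/-- **Row F-2829 `SeparatingCoverings` — all three clauses — at every one-cusp irreducible nodal datum,
`g ≥ 2`**: F-2826 (abc-iut-w5-d174's `verticialSeparatingCoverings_of_irreducibleNodal_affine`), F-2827 (this
file) and F-2828 (abc-iut-f-164's `unrRows_of_irreducibleNodal`). [cite: MochizukiCombGC2007, Prop 1.2 proof p.9] -/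
theorem separatingCoverings_of_irreducibleNodalOneCusp (hne : Sigma.Nonempty)
    (hprime : ∀ p ∈ Sigma, p.Prime) (ι : PuncturedSurfaceGroup g 1 →* P)
    (hι : IsProSigmaCompletion Sigma ι) (G : PSCDatum P) (hg : 1 ≤ g) (hg2 : 2 ≤ g)
    (e : G.graph.C ≃ Fin 1)
    (hC : ∀ c', G.cuspGp c' = ((cuspInertia (g := g) (e c')).map ι).topologicalClosure)
    (v₀ : G.graph.V) (hV : ∀ w, w = v₀) (n₀ : G.graph.N) (hN : ∀ n, n = n₀)
    (hE : G.nodeGp n₀ = ((Subgroup.zpowers (PuncturedSurfaceGroup.b (r := 1) (⟨0, hg⟩ : Fin g))).map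
      ι).topologicalClosure)
    (hV₀ : G.vertGp v₀ = ((Subgroup.closure {x : PuncturedSurfaceGroup g 1 |
        x = PuncturedSurfaceGroup.b ⟨0, hg⟩ ∨
        x = PuncturedSurfaceGroup.a ⟨0, hg⟩ * PuncturedSurfaceGroup.b ⟨0, hg⟩ * (PuncturedSurfaceGroup.a ⟨0, hg⟩)⁻¹ ∨
        (∃ i : Fin g, 1 ≤ (i : ℕ) ∧ (x = PuncturedSurfaceGroup.a i ∨ x = PuncturedSurfaceGroup.b i)) ∨
        ∃ j : Fin 1, x = PuncturedSurfaceGroup.c j}).map ι).topologicalClosure)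
    (hgen : G.genus v₀ = g - 1) :
    G.SeparatingCoverings :=
  ⟨G.verticialSeparatingCoverings_of_irreducibleNodal_affine (r := 0) hne hprime ι hι hg (Or.inl hg2) v₀ hV hV₀,
    G.edgeLikeSeparatingCoverings_of_irreducibleNodalOneCusp hne hprime ι hι hg hg2 e hC n₀ hN hE,
    (G.unrRows_of_irreducibleNodal hne hprime ι hι hg e hC v₀ hV n₀ hN hE hV₀ hgen).1⟩

/-- **[CombGC] Prop. 1.2 (i) and (ii), ALL typed clauses, at every one-cusp irreducible nodal datum, `g ≥ 2`**
(`prop12_of_separating`): the loop node and the cusp are commensurably terminal in `Π_G`.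
[cite: MochizukiCombGC2007, Prop 1.2 pp.8-9] -/
theorem prop12_of_irreducibleNodalOneCusp (hne : Sigma.Nonempty)
    (hprime : ∀ p ∈ Sigma, p.Prime) (ι : PuncturedSurfaceGroup g 1 →* P)
    (hι : IsProSigmaCompletion Sigma ι) (G : PSCDatum P) (hg : 1 ≤ g) (hg2 : 2 ≤ g)
    (e : G.graph.C ≃ Fin 1)
    (hC : ∀ c', G.cuspGp c' = ((cuspInertia (g := g) (e c')).map ι).topologicalClosure)
    (v₀ : G.graph.V) (hV : ∀ w, w = v₀) (n₀ : G.graph.N) (hN : ∀ n, n = n₀)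
    (hE : G.nodeGp n₀ = ((Subgroup.zpowers (PuncturedSurfaceGroup.b (r := 1) (⟨0, hg⟩ : Fin g))).map
      ι).topologicalClosure)
    (hV₀ : G.vertGp v₀ = ((Subgroup.closure {x : PuncturedSurfaceGroup g 1 |
        x = PuncturedSurfaceGroup.b ⟨0, hg⟩ ∨
        x = PuncturedSurfaceGroup.a ⟨0, hg⟩ * PuncturedSurfaceGroup.b ⟨0, hg⟩ * (PuncturedSurfaceGroup.a ⟨0, hg⟩)⁻¹ ∨
        (∃ i : Fin g, 1 ≤ (i : ℕ) ∧ (x = PuncturedSurfaceGroup.a i ∨ x = PuncturedSurfaceGroup.b i)) ∨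
        ∃ j : Fin 1, x = PuncturedSurfaceGroup.c j}).map ι).topologicalClosure)
    (hgen : G.genus v₀ = g - 1) :
    (G.VerticialOpenInterDeterminesVertex ∧ G.EdgeLikeOpenInterDeterminesEdge ∧
      G.UnrVerticialOpenInterDeterminesVertex) ∧
    (G.VerticialEdgeLikeCommensurablyTerminal ∧ G.UnrVerticialCommensurablyTerminal) :=
  G.prop12_of_separating (G.separatingCoverings_of_irreducibleNodalOneCusp hne hprime ι hι hg hg2 e hC v₀ hV n₀
    hN hE hV₀ hgen)

/-! ### Origin level: F-0438 (in full), F-0459, F-2830 at every origin of one-cusp irreducible nodal data -/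

/-- **F-0438 `CommensurableTerminalityHolds Ω` (BOTH clauses), F-0459 `OpenInterDeterminesComponentHolds Ω`
and F-2830 `SeparatingCoveringsHolds Ω` at EVERY origin whose data are one-cusp irreducible one-nodal data with
`g ≥ 2`** (hypothesis shape of `exists_irreducibleNodalDatum` at `r = 1`, profinite `Π` in `Type`).
[cite: MochizukiCombGC2007, Prop 1.2 pp.8-9] -/
theorem irreducibleNodalOneCuspOrigin_prop12_rows (Ω : PSCOrigin.{0})
    (hΩ : ∀ ⦃Q : Type⦄ [Group Q] [TopologicalSpace Q] [IsTopologicalGroup Q] (G : PSCDatum Q),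
      Ω.IsOfPSCType G → CompactSpace Q ∧ TotallyDisconnectedSpace Q ∧
        ∃ (S : Set ℕ) (g : ℕ) (hg : 1 ≤ g) (ι : PuncturedSurfaceGroup g 1 →* Q) (e : G.graph.C ≃ Fin 1)
          (v₀ : G.graph.V) (n₀ : G.graph.N),
          S.Nonempty ∧ (∀ p ∈ S, p.Prime) ∧ IsProSigmaCompletion S ι ∧ 2 ≤ g ∧
          (∀ c', G.cuspGp c' =
            ((cuspInertia (g := g) (e c')).map ι).topologicalClosure) ∧
          (∀ w, w = v₀) ∧ (∀ n, n = n₀) ∧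
          G.nodeGp n₀ = ((Subgroup.zpowers (PuncturedSurfaceGroup.b (r := 1) (⟨0, hg⟩ : Fin g))).map
            ι).topologicalClosure ∧
          G.vertGp v₀ = ((Subgroup.closure {x : PuncturedSurfaceGroup g 1 |
            x = PuncturedSurfaceGroup.b ⟨0, hg⟩ ∨
            x = PuncturedSurfaceGroup.a ⟨0, hg⟩ * PuncturedSurfaceGroup.b ⟨0, hg⟩ * (PuncturedSurfaceGroup.a ⟨0, hg⟩)⁻¹ ∨
            (∃ i : Fin g, 1 ≤ (i : ℕ) ∧ (x = PuncturedSurfaceGroup.a i ∨ x = PuncturedSurfaceGroup.b i)) ∨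
            ∃ j : Fin 1, x = PuncturedSurfaceGroup.c j}).map ι).topologicalClosure ∧
          G.genus v₀ = g - 1) :
    CommensurableTerminalityHolds Ω ∧ OpenInterDeterminesComponentHolds Ω ∧ SeparatingCoveringsHolds Ω := by
  have hsep : SeparatingCoveringsHolds Ω := by
    intro Q _ _ _ G hG
    obtain ⟨hc, hd, S, g, hg, ι, e, v₀, n₀, hne, hprime, hι, hg2, hC, hV, hN, hE, hV₀, hgen⟩ := hΩ G hG
    haveI := hc
    haveI := hd
    exact G.separatingCoverings_of_irreducibleNodalOneCusp hne hprime ι hι hg hg2 e hC v₀ hV n₀ hN hE hV₀ hgen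
  have hprof : ∀ ⦃Q : Type⦄ [Group Q] [TopologicalSpace Q] [IsTopologicalGroup Q] (G : PSCDatum Q),
      Ω.IsOfPSCType G → CompactSpace Q ∧ TotallyDisconnectedSpace Q := fun Q _ _ _ G hG => by
    obtain ⟨hc, hd, -⟩ := hΩ G hG
    exact ⟨hc, hd⟩
  exact ⟨commensurableTerminalityHolds_of_separating Ω hsep hprof,
    openInterDeterminesComponentHolds_of_separating Ω hsep hprof, hsep⟩

/-- **Non-vacuity: at the inhabited origin of one-cusp irreducible nodal data — every `g ≥ 2`, every nonempty set
`Σ` of primes — F-0438 (BOTH clauses: loop node and cusp commensurably terminal), F-0459 (all three clauses) and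
F-2830 (all three cases) ALL HOLD**, the inhabitant being abc-iut-f-164's `exists_irreducibleNodalDatum Σ … g 1`.
[cite: MochizukiCombGC2007, Prop 1.2 pp.8-9] -/
theorem exists_irreducibleNodalOneCuspOrigin_prop12_holds_all (Sigma : Set ℕ) (hne : Sigma.Nonempty)
    (hprime : ∀ p ∈ Sigma, p.Prime) {g : ℕ} (hg2 : 2 ≤ g) :
    ∃ Ω : PSCOrigin.{0},
      (∃ (Q : ProfiniteGrp.{0}) (ι : PuncturedSurfaceGroup g 1 →* Q) (G : PSCDatum Q) (v₀ : G.graph.V),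
        IsProSigmaCompletion Sigma ι ∧ Ω.IsOfPSCType G ∧ G.Sigma = Sigma ∧ G.graph.i = 1 ∧ G.graph.n = 1 ∧
          G.graph.r = 1 ∧ (∀ w, w = v₀) ∧ G.genus v₀ = g - 1) ∧
      CommensurableTerminalityHolds Ω ∧ OpenInterDeterminesComponentHolds Ω ∧ SeparatingCoveringsHolds Ω := by
  classical
  have hg : 1 ≤ g := by omega
  let Ω : PSCOrigin.{0} :=
    ⟨fun {Q} _ _ G => ∃ (_ : IsTopologicalGroup Q), CompactSpace Q ∧ TotallyDisconnectedSpace Q ∧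
        ∃ (S : Set ℕ) (g : ℕ) (hg : 1 ≤ g) (ι : PuncturedSurfaceGroup g 1 →* Q) (e : G.graph.C ≃ Fin 1)
          (v₀ : G.graph.V) (n₀ : G.graph.N),
          S.Nonempty ∧ (∀ p ∈ S, p.Prime) ∧ IsProSigmaCompletion S ι ∧ 2 ≤ g ∧
          (∀ c', G.cuspGp c' =
            ((cuspInertia (g := g) (e c')).map ι).topologicalClosure) ∧
          (∀ w, w = v₀) ∧ (∀ n, n = n₀) ∧
          G.nodeGp n₀ = ((Subgroup.zpowers (PuncturedSurfaceGroup.b (r := 1) (⟨0, hg⟩ : Fin g))).map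
            ι).topologicalClosure ∧
          G.vertGp v₀ = ((Subgroup.closure {x : PuncturedSurfaceGroup g 1 |
            x = PuncturedSurfaceGroup.b ⟨0, hg⟩ ∨
            x = PuncturedSurfaceGroup.a ⟨0, hg⟩ * PuncturedSurfaceGroup.b ⟨0, hg⟩ * (PuncturedSurfaceGroup.a ⟨0, hg⟩)⁻¹ ∨
            (∃ i : Fin g, 1 ≤ (i : ℕ) ∧ (x = PuncturedSurfaceGroup.a i ∨ x = PuncturedSurfaceGroup.b i)) ∨
            ∃ j : Fin 1, x = PuncturedSurfaceGroup.c j}).map ι).topologicalClosure ∧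
          G.genus v₀ = g - 1⟩
  refine ⟨Ω, ?_, irreducibleNodalOneCuspOrigin_prop12_rows Ω fun Q _ _ _ G hG => hG.2⟩
  obtain ⟨Q, ι, G, e, v₀, n₀, hι, hS, hi, hn, hr, hC, hV, hN, hE, hV₀, hgen, -⟩ :=
    exists_irreducibleNodalDatum Sigma hne hprime g 1 hg
  have hG : Ω.IsOfPSCType G := ⟨inferInstance, inferInstance, inferInstance, Sigma, g, hg, ι, e, v₀, n₀, hne, hprime,
    hι, hg2, hC, hV, hN, hE, hV₀, hgen⟩
  exact ⟨Q, ι, G, v₀, hι, hG, hS, hi, hn, hr, hV, hgen⟩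

end PSCDatum

end Literature.AnabelianGeometry.SemiGraphs
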